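import Summits.QuantumFields.BalabanUV.Beta.WardLocusRecursive
import Summits.QuantumFields.BalabanUV.Beta.SpineRootedBmN

/-!
# The RECURSIVELY TYPED wall family — packaging leaf-10's `WardLocusRecursive.SrecAt` as step jet data: `jsRecAtOf`, `JsRec0AtOf`,
# the Π_bm-co-dressed family `JsRecBmAtOf := dressBmAt ρ ∘ JsRec0AtOf`, its (St♭)/(Wt) sockets, and the base `hR` wiring
# `axisReflectionCovariant_flipK_TbalOf_JsRecBmAtOf_ctrC` (β sub-cell, row BETA-an2 = BINDER-OWNERS row D1, gen 16; decision (L3-D′))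

HONEST FRAMING (cell charter, verbatim): «discharging BetaPertH makes Balaban's UV stability UNCONDITIONAL — a real
constructive-QFT result; it is NOT the continuum limit and NOT the Clay problem.»  DERIVED cell leaf (pub-balaban β sub-cell, lane
an2 gen 16); no statement of Bałaban's papers is typed here, no `[cite:]` tag, no `Prop` fact; it instantiates no binder of the
β-function wall by itself.  NOT `BetaPertH`; NOT continuum; NOT Clay.

ROW-OWNER DECISION (L3-D′) (journal 2026-08-20, refining (L3-D)): the step jets of the wall family are typed RECURSIVELY over the
wall's own Π_bm-co-dressed step propagators `G_j := coDressKBmAt ρ Lc (KInvStep Lc j)` — member `j+1`'s cubic sector is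
`e3OfK Lc G_j (S j)` (the level-`j` stencil dressed and sandwiched by the level-`j` propagator at blocking `Lc`), NOT the one-shot
`e3NAtOf (j+1)` over the straight composite resolvent.  The S-tables are leaf-10's `WardLocusRecursive.SrecAt d Lc ρ cE cVH cΛ`
VERBATIM (adopted by name; member `0` = `S0NAt ρ`).  The identification «recursive jets = one-shot composite jets» is a D1Tel-type
identity and is NOT claimed anywhere.

## What is here

* `jsRecAtOf … j : JetData d Lc` — `(SrecAt (toSite r) … j, W j)` with the locality radii of `locStencil_SrecAt` / the tables (`_S`, `_W` by `rfl`);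
  `JsRec0AtOf … : ℕ → JetData d Lc := fun j ↦ jsRecAtOf … j` (uniform in `j` — no `match`); `JsRecBmAtOf … := fun j ↦ dressBmAt hr (JsRec0AtOf … j)`.
* (St♭)/(Wt): `JsRec0AtOf_S_translate` (leaf-10's `SrecAt_translate`), `JsRec0AtOf_W_translate`, `JsRecBmAtOf_S_translate`,
  `JsRecBmAtOf_W_translate` (an2's `dressBmAtS/W_translate`).
* **`axisReflectionCovariant_flipK_TbalOf_JsRecBmAtOf_ctrC`** — the wiring `SpineRooted.axisReflectionCovariant_flipK_TbalOf_JsBalBmNAtOf_ctrC`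
  VERBATIM with `JsBal0NAtOf ↦ JsRec0AtOf`: `∀ j, AxisReflectionCovariant (flipK (TbalOf Lc (JsRecBmAtOf …) j))` (`d + 1 = 4`, odd `Lc`,
  centred root) from EXACTLY a spread `𝕄 j` with rules 3–4 against `axEc` (rules 1–2 inside, `axEc_rules_coDressKBmAt_KInvStep`), contact
  families commuting with `axEc`, and the conjugated jet laws (Sr-conj)/(Wr-conj) of the UNDRESSED recursive family against `𝕄 j`.

All declarations `[folklore]`; axioms standard.  Provenance: b2b-balaban β sub-cell, unit beta-an2 gen 16, 2026-08-20 (v1); over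
`WardLocusRecursive` (leaf-10), `SpineRootedBmN`/`AxialDressingRootedBmHessian` (an2) BY NAME; no existing file touched.
-/

open Finset
open scoped BigOperators
open Literature.MathematicalPhysics.QuantumFieldTheory
open Literature.MathematicalPhysics.QuantumFieldTheory.Balaban1983to89
open Literature.MathematicalPhysics.QuantumFieldTheory.Balaban1983to89.Beta
open ExpKernelCalculus (MKer Decays BiLoc comp VertexFamily VertexFamily₂ shiftK)
open AffineAveraging (box toSite)
open AveragingContoursRooted (ctrOff ctrOff_mem_box)
open PolarizationSign (reflSign AxisReflectionCovariant)
open KernelReflection (refK)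
open ResolventReflection (bref Φ)
open OneStepResolventKernel (Fib LocStencil JetData)
open OneStepKernelFamily (KInvStep vertexOfK TbalOf flipK)
open BalabanStepJets (locStencil_mono vertexFamily₂_mono)
open Summit.QuantumFields.BalabanUV.Beta.TameKernelCalculus
open Summit.QuantumFields.BalabanUV.Beta.ChartConjugation (conjV conjW)
open Summit.QuantumFields.BalabanUV.Beta.ChartConjugationRelative (RelInv)
open Summit.QuantumFields.BalabanUV.Beta.AxialDressingRooted (dressBmAt dressBmAt_S dressBmAt_W dressBmAtS_translate dressBmAtW_translate
  coDressKBmAt axEc spr_axEc axEc_rules_coDressKBmAt_KInvStep axisReflectionCovariant_flipK_TbalOf_dressBmCtr_rel one_le_of_neZero)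
open Summit.QuantumFields.BalabanUV.Beta.WardLocusRecursive (SrecAt locStencil_SrecAt SrecAt_translate)

noncomputable section

namespace Summit.QuantumFields.BalabanUV.Beta.SpineRooted

variable {d : ℕ}

/-! ## §1 The recursive step jet data and the undressed family `JsRec⁰_ρ` -/

section Family

variable {Lc : ℕ} [NeZero Lc]

/-- [folklore] **THE RECURSIVE STEP-`j` JET DATUM** `(SrecAt (toSite r) cE cVH cΛ j, W j)`: first-order tables = leaf-10's recursively typed
stencil family (member `0` = `S0NAt`, member `j+1` = cubic sector over `G_j` + border + Λ), second-order tables the supplied `W j`; locality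
radius = the minimum of the (existential) radius of `locStencil_SrecAt … j` and `δw j`. -/
def jsRecAtOf (hLc : 1 ≤ Lc) {r : Fin (d + 1) → ℕ} (hr : r ∈ box (d + 1) Lc) (cE cVH cΛ : ℝ)
    (W : ℕ → Fin (d + 1) → (Fin (d + 1) → ℤ) → Fin (d + 1) → (Fin (d + 1) → ℤ) → MKer (d + 1) (Fib d))
    (Cw δw : ℕ → ℝ) (hδw : ∀ j, 0 < δw j) (hW : ∀ j, VertexFamily₂ (W j) Lc (Cw j) (δw j)) (j : ℕ) : JetData d Lc :=
  have hS := locStencil_SrecAt (d := d) (Lc := Lc) hLc hr cE cVH cΛ j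
  have hδS : 0 < hS.choose_spec.choose := hS.choose_spec.choose_spec.1
  have hloc : LocStencil (SrecAt d Lc (toSite r) cE cVH cΛ j) hS.choose hS.choose_spec.choose := hS.choose_spec.choose_spec.2
  { S := SrecAt d Lc (toSite r) cE cVH cΛ j
    W := W j
    Cs := hS.choose
    Cw := Cw j
    δ := min hS.choose_spec.choose (δw j)
    δ_pos := lt_min hδS (hδw j)
    loc := locStencil_mono hloc ((hloc 0 0).nonneg (Sum.inl 0)) (min_le_left _ _)
    loc₂ := vertexFamily₂_mono (hW j) ((hW j 0 0 0 0).nonneg (Sum.inl 0)) (min_le_right _ _) }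

variable (hLc : 1 ≤ Lc) {r : Fin (d + 1) → ℕ} (hr : r ∈ box (d + 1) Lc) (cE cVH cΛ : ℝ)
    (W : ℕ → Fin (d + 1) → (Fin (d + 1) → ℤ) → Fin (d + 1) → (Fin (d + 1) → ℤ) → MKer (d + 1) (Fib d))
    (Cw δw : ℕ → ℝ) (hδw : ∀ j, 0 < δw j) (hW : ∀ j, VertexFamily₂ (W j) Lc (Cw j) (δw j))

/-- [folklore] The first-order table of the recursive member `j` is `SrecAt (toSite r) … j`. -/
@[simp] theorem jsRecAtOf_S (j : ℕ) : (jsRecAtOf hLc hr cE cVH cΛ W Cw δw hδw hW j).S = SrecAt d Lc (toSite r) cE cVH cΛ j := rfl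

/-- [folklore] The second-order table of the recursive member `j` is the supplied `W j`. -/
@[simp] theorem jsRecAtOf_W (j : ℕ) : (jsRecAtOf hLc hr cE cVH cΛ W Cw δw hδw hW j).W = W j := rfl

/-- [folklore] **THE UNDRESSED RECURSIVE FAMILY `JsRec⁰_ρ`**: `j ↦ jsRecAtOf … j` (uniform in `j`; second-order tables `W j` abstract —
their placement is the consumer's). -/
def JsRec0AtOf : ℕ → JetData d Lc := fun j => jsRecAtOf hLc hr cE cVH cΛ W Cw δw hδw hW j

/-- [folklore] Member `j` (unfolding lemma). -/
theorem JsRec0AtOf_apply (j : ℕ) : JsRec0AtOf hLc hr cE cVH cΛ W Cw δw hδw hW j = jsRecAtOf hLc hr cE cVH cΛ W Cw δw hδw hW j := rfl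

/-- [folklore] The first-order table of member `j` is `SrecAt (toSite r) … j`. -/
@[simp] theorem JsRec0AtOf_S (j : ℕ) : (JsRec0AtOf hLc hr cE cVH cΛ W Cw δw hδw hW j).S = SrecAt d Lc (toSite r) cE cVH cΛ j := rfl

/-- [folklore] The second-order table of member `j` is the supplied `W j`. -/
@[simp] theorem JsRec0AtOf_W (j : ℕ) : (JsRec0AtOf hLc hr cE cVH cΛ W Cw δw hδw hW j).W = W j := rfl

/-- [folklore] **(St♭) FOR `JsRec⁰_ρ`**, every member — leaf-10's `SrecAt_translate`. -/
theorem JsRec0AtOf_S_translate (j : ℕ) (κ' : Fin (d + 1)) (u t : Fin (d + 1) → ℤ) :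
    (JsRec0AtOf hLc hr cE cVH cΛ W Cw δw hδw hW j).S κ' (u + (Lc : ℤ) • t)
      = shiftK (-((Lc : ℤ) • t)) ((JsRec0AtOf hLc hr cE cVH cΛ W Cw δw hδw hW j).S κ' u) := by
  rw [JsRec0AtOf_S]
  exact SrecAt_translate (toSite r) hLc cE cVH cΛ j κ' u t

/-- [folklore] **(Wt) FOR `JsRec⁰_ρ`** from that of the tables. -/
theorem JsRec0AtOf_W_translate
    (hWt : ∀ (j : ℕ) (μ : Fin (d + 1)) (y : Fin (d + 1) → ℤ) (ν : Fin (d + 1)) (y' t : Fin (d + 1) → ℤ),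
      W j μ (y + t) ν (y' + t) = shiftK (-((Lc : ℤ) • t)) (W j μ y ν y'))
    (j : ℕ) (μ : Fin (d + 1)) (y : Fin (d + 1) → ℤ) (ν : Fin (d + 1)) (y' t : Fin (d + 1) → ℤ) :
    (JsRec0AtOf hLc hr cE cVH cΛ W Cw δw hδw hW j).W μ (y + t) ν (y' + t)
      = shiftK (-((Lc : ℤ) • t)) ((JsRec0AtOf hLc hr cE cVH cΛ W Cw δw hδw hW j).W μ y ν y') := by
  rw [JsRec0AtOf_W]
  exact hWt j μ y ν y' t

/-! ## §2 The Π_bm-co-dressed recursive family `JsRecBm_ρ` -/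

/-- [folklore] **THE ROOTED Π_bm-CO-DRESSED RECURSIVE FAMILY**: `JsRecBm_ρ := dressBmAt ρ ∘ JsRec⁰_ρ` — the wall-literal candidate v2.26 of
decision (L3-D′) (colour pin `(cE, cVH, cΛ)` = (P6), lead's (R45)). -/
def JsRecBmAtOf : ℕ → JetData d Lc := fun j => dressBmAt hr (JsRec0AtOf hLc hr cE cVH cΛ W Cw δw hδw hW j)

/-- [folklore] `JsRecBm_ρ` is `dressBmAt ρ ∘ JsRec⁰_ρ`, by definition. -/
theorem JsRecBmAtOf_apply (j : ℕ) :
    JsRecBmAtOf hLc hr cE cVH cΛ W Cw δw hδw hW j = dressBmAt hr (JsRec0AtOf hLc hr cE cVH cΛ W Cw δw hδw hW j) := rfl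

/-- [folklore] **(St♭) FOR `JsRecBm_ρ`**, every member — an2's `AxialDressingRooted.dressBmAtS_translate`. -/
theorem JsRecBmAtOf_S_translate (j : ℕ) (κ' : Fin (d + 1)) (u t : Fin (d + 1) → ℤ) :
    (JsRecBmAtOf hLc hr cE cVH cΛ W Cw δw hδw hW j).S κ' (u + (Lc : ℤ) • t)
      = shiftK (-((Lc : ℤ) • t)) ((JsRecBmAtOf hLc hr cE cVH cΛ W Cw δw hδw hW j).S κ' u) := by
  show (dressBmAt hr (JsRec0AtOf hLc hr cE cVH cΛ W Cw δw hδw hW j)).S κ' (u + (Lc : ℤ) • t)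
    = shiftK (-((Lc : ℤ) • t)) ((dressBmAt hr (JsRec0AtOf hLc hr cE cVH cΛ W Cw δw hδw hW j)).S κ' u)
  rw [dressBmAt_S, dressBmAt_S]
  exact dressBmAtS_translate (toSite r) hLc (JsRec0AtOf_S_translate hLc hr cE cVH cΛ W Cw δw hδw hW j) κ' u t

/-- [folklore] **(Wt) FOR `JsRecBm_ρ` FROM (Wt) OF THE TABLES** — an2's `AxialDressingRooted.dressBmAtW_translate`. -/
theorem JsRecBmAtOf_W_translate
    (hWt : ∀ (j : ℕ) (μ : Fin (d + 1)) (y : Fin (d + 1) → ℤ) (ν : Fin (d + 1)) (y' t : Fin (d + 1) → ℤ),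
      W j μ (y + t) ν (y' + t) = shiftK (-((Lc : ℤ) • t)) (W j μ y ν y'))
    (j : ℕ) (μ : Fin (d + 1)) (y : Fin (d + 1) → ℤ) (ν : Fin (d + 1)) (y' t : Fin (d + 1) → ℤ) :
    (JsRecBmAtOf hLc hr cE cVH cΛ W Cw δw hδw hW j).W μ (y + t) ν (y' + t)
      = shiftK (-((Lc : ℤ) • t)) ((JsRecBmAtOf hLc hr cE cVH cΛ W Cw δw hδw hW j).W μ y ν y') := by
  show (dressBmAt hr (JsRec0AtOf hLc hr cE cVH cΛ W Cw δw hδw hW j)).W μ (y + t) ν (y' + t)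
    = shiftK (-((Lc : ℤ) • t)) ((dressBmAt hr (JsRec0AtOf hLc hr cE cVH cΛ W Cw δw hδw hW j)).W μ y ν y')
  rw [dressBmAt_W, dressBmAt_W, JsRec0AtOf_W]
  exact dressBmAtW_translate (toSite r) hLc (hWt j) μ y ν y' t

end Family

/-! ## §3 `hR` for the centred co-dressed recursive family over the coarse coordinate projector (base wiring) -/

section Wiring

/-- [folklore] **`hR` FOR THE CENTRED Π_bm-CO-DRESSED RECURSIVE FAMILY OVER `axEc`** — the wiring
`axisReflectionCovariant_flipK_TbalOf_JsBalBmNAtOf_ctrC` with `JsBal0NAtOf ↦ JsRec0AtOf`: from a spread `𝕄 j` with rules 3–4 against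
`axEc ρ_c Lc` (rules 1–2 inside by `axEc_rules_coDressKBmAt_KInvStep`), contact families commuting with `axEc`, and the conjugated jet laws
(Sr-conj)/(Wr-conj) of the undressed recursive family.  Discharges nothing of the wall by itself. -/
theorem axisReflectionCovariant_flipK_TbalOf_JsRecBmAtOf_ctrC {Lc : ℕ} [NeZero Lc] (hLc : Odd Lc) (cE cVH cΛ : ℝ)
    (W : ℕ → Fin 4 → (Fin 4 → ℤ) → Fin 4 → (Fin 4 → ℤ) → MKer 4 (Fib 3)) (Cw δw : ℕ → ℝ) (hδw : ∀ j, 0 < δw j)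
    (hW : ∀ j, VertexFamily₂ (W j) Lc (Cw j) (δw j))
    (hWt : ∀ (j : ℕ) (μ : Fin 4) (y : Fin 4 → ℤ) (ν : Fin 4) (y' t : Fin 4 → ℤ),
      W j μ (y + t) ν (y' + t) = shiftK (-((Lc : ℤ) • t)) (W j μ y ν y'))
    (M : ℕ → MKer 4 (Fib 3)) (hM : ∀ j, Spr (M j))
    (h3 : ∀ j, comp (comp (coDressKBmAt (toSite (ctrOff 4 Lc)) Lc (KInvStep (d := 3) Lc j)) (M j)) (axEc (toSite (ctrOff 4 Lc)) Lc) =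
      axEc (toSite (ctrOff 4 Lc)) Lc)
    (h4 : ∀ j, comp (comp (axEc (toSite (ctrOff 4 Lc)) Lc) (M j)) (coDressKBmAt (toSite (ctrOff 4 Lc)) Lc (KInvStep (d := 3) Lc j)) =
      axEc (toSite (ctrOff 4 Lc)) Lc)
    (C : ℕ → Fin 4 → Fin 4 → (Fin 4 → ℤ) → MKer 4 (Fib 3)) (Cc δc : ℕ → ℝ) (hC : ∀ j α, LocStencil (C j α) (Cc j) (δc j))
    (hδc : ∀ j, 0 < δc j) (X₂ : ℕ → Fin 4 → Fin 4 → (Fin 4 → ℤ) → Fin 4 → (Fin 4 → ℤ) → MKer 4 (Fib 3))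
    (hX₂ : ∀ j α μ y ν y', Loc (X₂ j α μ y ν y'))
    (hEC : ∀ j α κ' u, comp (axEc (toSite (ctrOff 4 Lc)) Lc) (C j α κ' u) = comp (C j α κ' u) (axEc (toSite (ctrOff 4 Lc)) Lc))
    (hEX₂ : ∀ j α μ y ν y', comp (axEc (toSite (ctrOff 4 Lc)) Lc) (X₂ j α μ y ν y') = comp (X₂ j α μ y ν y') (axEc (toSite (ctrOff 4 Lc)) Lc))
    (hSrC : ∀ (j : ℕ) (α κ' : Fin 4) (u : Fin 4 → ℤ),
      (JsRec0AtOf (d := 3) hLc.pos (ctrOff_mem_box hLc.pos) cE cVH cΛ W Cw δw hδw hW j).S κ' (bref α κ' u) =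
        reflSign α κ' • refK (Φ Lc α)
          ((JsRec0AtOf (d := 3) hLc.pos (ctrOff_mem_box hLc.pos) cE cVH cΛ W Cw δw hδw hW j).S κ' u + conjV (M j) (C j α κ' u)))
    (hWrC : ∀ (j : ℕ) (α μ : Fin 4) (y : Fin 4 → ℤ) (ν : Fin 4) (y' : Fin 4 → ℤ),
      (JsRec0AtOf (d := 3) hLc.pos (ctrOff_mem_box hLc.pos) cE cVH cΛ W Cw δw hδw hW j).W μ (bref α μ y) ν (bref α ν y') =
        (reflSign α μ * reflSign α ν) • refK (Φ Lc α)
          ((JsRec0AtOf (d := 3) hLc.pos (ctrOff_mem_box hLc.pos) cE cVH cΛ W Cw δw hδw hW j).W μ y ν y' +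
            conjW (M j)
              (vertexOfK (coDressKBmAt (toSite (ctrOff 4 Lc)) Lc (KInvStep (d := 3) Lc j)) Lc
                (JsRec0AtOf (d := 3) hLc.pos (ctrOff_mem_box hLc.pos) cE cVH cΛ W Cw δw hδw hW j).S μ y)
              (vertexOfK (coDressKBmAt (toSite (ctrOff 4 Lc)) Lc (KInvStep (d := 3) Lc j)) Lc
                (JsRec0AtOf (d := 3) hLc.pos (ctrOff_mem_box hLc.pos) cE cVH cΛ W Cw δw hδw hW j).S ν y')
              (vertexOfK (coDressKBmAt (toSite (ctrOff 4 Lc)) Lc (KInvStep (d := 3) Lc j)) Lc (C j α) μ y)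
              (vertexOfK (coDressKBmAt (toSite (ctrOff 4 Lc)) Lc (KInvStep (d := 3) Lc j)) Lc (C j α) ν y') (X₂ j α μ y ν y'))) :
    ∀ j : ℕ, AxisReflectionCovariant
      (flipK (TbalOf Lc (JsRecBmAtOf (d := 3) hLc.pos (ctrOff_mem_box hLc.pos) cE cVH cΛ W Cw δw hδw hW) j)) := by
  have hR : ∀ j, RelInv (coDressKBmAt (toSite (ctrOff 4 Lc)) Lc (KInvStep (d := 3) Lc j)) (M j) (axEc (toSite (ctrOff 4 Lc)) Lc) :=
    fun j => ⟨(axEc_rules_coDressKBmAt_KInvStep (ctrOff_mem_box (one_le_of_neZero Lc)) j).1,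
      (axEc_rules_coDressKBmAt_KInvStep (ctrOff_mem_box (one_le_of_neZero Lc)) j).2, h3 j, h4 j⟩
  exact axisReflectionCovariant_flipK_TbalOf_dressBmCtr_rel hLc
    (JsRec0AtOf (d := 3) hLc.pos (ctrOff_mem_box hLc.pos) cE cVH cΛ W Cw δw hδw hW) M (axEc (toSite (ctrOff 4 Lc)) Lc) hM
    (spr_axEc _ _) hR (JsRec0AtOf_S_translate hLc.pos (ctrOff_mem_box hLc.pos) cE cVH cΛ W Cw δw hδw hW)
    (JsRec0AtOf_W_translate hLc.pos (ctrOff_mem_box hLc.pos) cE cVH cΛ W Cw δw hδw hW hWt) C Cc δc hC hδc X₂ hX₂ hEC hEX₂ hSrC hWrC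

end Wiring

end Summit.QuantumFields.BalabanUV.Beta.SpineRooted

end
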